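import Summits.FinalStateConjecture.FinalStateConjecture.Theorems.SwallowTheDatumKerrShieldedDataExistStubSliceClause
import Summits.FinalStateConjecture.FinalStateConjecture.Theorems.SwallowTheDatumKerrShieldedDataExistAssemblyProfile
import Summits.FinalStateConjecture.FinalStateConjecture.Theorems.SwallowTheDatumKerrShieldedDataExistAssemblyLeafNear
import Summits.FinalStateConjecture.FinalStateConjecture.Theorems.SwallowTheDatumKerrShieldedDataExistAssemblyLeafFar
import Summits.FinalStateConjecture.FinalStateConjecture.Theorems.SwallowTheDatumKerrShieldedDataExistBridgeProfileAssembly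
import Literature.Geometry.Lorentzian.InitialDataLocality
import Literature.Geometry.Lorentzian.ModelData
import Literature.Geometry.Lorentzian.LeviCivitaProofs
import HarnessLib

/-!
# `KerrShieldedDataExist`, line `plug-the-second-sheet` — the assembly, VI: the end chart and the leaf zone

Support file (everything proved; no definitions, no named facts) for stub `stub_assembly` of crux
`stmt-FinalStateConjecture-10055`. The LEAF ZONE `{|x| > r₁}` of the glued datum carries the push-forward, along
the end chart `φ(y) = (S(|y|)/|y|) y`, of the datum INDUCED on the crux's pinned graph `ψ_T = Negative.graph M 0 r₁`
(the bent Kerr–Schild/Boyer–Lindquist leaf) with its future unit normal `N₀`; as `φ⁻¹ = ψ_Q : x ↦ (Q(|x|)/|x|) x`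
(`(Q, S)` the radial profile of `…AssemblyProfile`), this push-forward is the pull-back `ψ_Q^*(ψ_T^* g, K_{N₀})`
(`InitialDataSet.comap`, Bartnik–Isenberg 2004, §2).

* `radialScale_mem_slice`, `contMDiff_of_radialScale`, `comp_eq_id_of_radialScale`, `mfderiv_comp_apply_of_comp_eq_id`,
  `injective_mfderiv_of_comp_eq_id`, `eventuallyEq_id_of_radialScale`, `mfderiv_eq_id_of_radialScale` — `φ_S`, `ψ_Q`
  are mutually inverse smooth self-maps of `Kerr.slice 0 r₁` (`0 < r₁ < 4M`), `= id` to first order below `4M`;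
* `far_deriv` — beyond `7M`, where `Q(ρ) = (2ρ + M)²/(4ρ)`, the re-read leaf `(T ∘ Q, Q)` has the Boyer–Lindquist
  derivatives `Q′ = (2ρ − M)(2ρ + M)/(4ρ²)`, `(T∘Q)′ = 2M(2ρ + M)/(ρ(2ρ − M))` (and `Q(ρ) > 8M`);
* `exists_leafZoneData` — the leaf-zone datum `Dl` on `Kerr.slice 0 r₁`: vacuum (`isVacuumConstraintSolution_comap'`);
  `= (hRep, kRep)` below `4M` (`…AssemblyLeafNear`); `= ((1 + M/2|x|)⁴ δ, 0)` beyond `7M` (the leaf re-read by `ψ_Q` is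
  the Boyer–Lindquist slice in ISOTROPIC radius, `Bridge.bilin_tangent_tangent_eq_iso`, and is totally geodesic,
  `…AssemblyLeafFar`); and the pull-back identities `φ^* Dl = (ψ_T^* g, K_{N₀})` (chain rule, `ψ_Q ∘ φ_S = id`), which
  are the crux's shielding clauses.

References: Bartnik–Isenberg 2004, §2; Wald 1984, §6.4; Cook 2000, §3.2.2; O'Neill 1983, Ch. 4.
-/

-- the doubled `FinalStateConjecture` path component is the summit/problem naming scheme, not a mistake
set_option linter.dupNamespace false

noncomputable section

open Set Filter Topology TopologicalSpace
open scoped Manifold ContDiff Topology InnerProductSpace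
open Literature.Geometry.Lorentzian
open Summit.FinalStateConjecture.FinalStateConjecture.Theorems.KerrShieldedDataExist

namespace Summit.FinalStateConjecture.FinalStateConjecture.Theorems.SwallowTheDatum

namespace Assembly

section Maps

variable {r₁ : ℝ} {f g : ℝ → ℝ} {φ ψ : Kerr.slice 0 r₁ → Kerr.slice 0 r₁}

/-- A radial re-scaling by a strictly increasing profile fixing `r₁ > 0` maps the slice `{|y| > r₁}` into itself.
[folklore] -/
theorem radialScale_mem_slice (hr₁ : 0 < r₁) (hf : StrictMono f) (hfr : f r₁ = r₁) {y : E3} (hy : y ∈ Kerr.slice 0 r₁) :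
    (f ‖y‖ / ‖y‖) • y ∈ Kerr.slice 0 r₁ := by
  rw [Kerr.mem_slice_zero_iff, max_eq_left hr₁.le] at hy ⊢
  have hy0 : y ≠ 0 := norm_pos_iff.1 (hr₁.trans hy)
  have hfy : r₁ < f ‖y‖ := hfr.symm.trans_lt (hf hy)
  rwa [norm_radialScale hy0 (hr₁.trans hfy)]

/-- The norm of a point of the slice re-scaled by a strictly increasing profile fixing `r₁ > 0`. [folklore] -/
theorem norm_radialScale_slice (hr₁ : 0 < r₁) (hf : StrictMono f) (hfr : f r₁ = r₁) (y : Kerr.slice 0 r₁) :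
    ‖(f ‖(y : E3)‖ / ‖(y : E3)‖) • (y : E3)‖ = f ‖(y : E3)‖ := by
  have hy := y.2
  rw [Kerr.mem_slice_zero_iff, max_eq_left hr₁.le] at hy
  have hfy : r₁ < f ‖(y : E3)‖ := hfr.symm.trans_lt (hf hy)
  exact norm_radialScale (Kerr.ne_zero_of_mem_slice_zero y) (hr₁.trans hfy)

/-- **A self-map of the slice represented by a radial re-scaling with `C^∞` profile is `C^n` in every degree.**
[folklore] -/
theorem contMDiff_of_radialScale (hf : ContDiff ℝ ∞ f) (hφ : ∀ y, (φ y : E3) = (f ‖(y : E3)‖ / ‖(y : E3)‖) • (y : E3))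
    {n : ℕ∞ω} (hn : n ≤ ∞) : ContMDiff 𝓘(ℝ, E3) 𝓘(ℝ, E3) n φ := by
  intro y
  have h1 : ContMDiffAt 𝓘(ℝ, E3) 𝓘(ℝ, E3) n (fun y : Kerr.slice 0 r₁ ↦ (f ‖(y : E3)‖ / ‖(y : E3)‖) • (y : E3)) y :=
    (OpensChart.contMDiffAt_iff y _ (fun z : E3 ↦ (f ‖z‖ / ‖z‖) • z) (fun _ ↦ rfl)).2
      ((contDiffAt_radialScale (Kerr.ne_zero_of_mem_slice_zero y) hf.contDiffAt).of_le hn)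
  have h2 : (Subtype.val ∘ φ) = fun y : Kerr.slice 0 r₁ ↦ (f ‖(y : E3)‖ / ‖(y : E3)‖) • (y : E3) := funext hφ
  have h3 : ContMDiffAt 𝓘(ℝ, E3) 𝓘(ℝ, E3) n (Subtype.val ∘ φ) y := by rw [h2]; exact h1
  exact (ChartedSpace.liftPropWithinAt_subtypeVal_comp_iff φ Set.univ y).mp h3

/-- **Mutually inverse profiles give mutually inverse re-scalings**: `ψ ∘ φ = id` on the slice when `g ∘ f = id`
(and `f > 0` on the radii of the slice). [folklore] -/
theorem comp_eq_id_of_radialScale (hr₁ : 0 < r₁) (hf : StrictMono f) (hfr : f r₁ = r₁) (hgf : ∀ s, g (f s) = s)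
    (hφ : ∀ y, (φ y : E3) = (f ‖(y : E3)‖ / ‖(y : E3)‖) • (y : E3))
    (hψ : ∀ y, (ψ y : E3) = (g ‖(y : E3)‖ / ‖(y : E3)‖) • (y : E3)) : ψ ∘ φ = id := by
  funext y
  apply Subtype.ext
  have hy := y.2
  rw [Kerr.mem_slice_zero_iff, max_eq_left hr₁.le] at hy
  have hfy : r₁ < f ‖(y : E3)‖ := hfr.symm.trans_lt (hf hy)
  rw [Function.comp_apply, hψ, hφ, id]
  exact radialScale_radialScale (Kerr.ne_zero_of_mem_slice_zero y) (hr₁.trans hfy) (hgf _)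

/-- **Chain rule for mutually inverse smooth self-maps of the slice**: `dψ_{φ y}(dφ_y v) = v`. [folklore] -/
theorem mfderiv_comp_apply_of_comp_eq_id (hφ : ContMDiff 𝓘(ℝ, E3) 𝓘(ℝ, E3) ∞ φ) (hψ : ContMDiff 𝓘(ℝ, E3) 𝓘(ℝ, E3) ∞ ψ)
    (hid : ψ ∘ φ = id) (y : Kerr.slice 0 r₁) (v : E3) :
    mfderiv 𝓘(ℝ, E3) 𝓘(ℝ, E3) ψ (φ y) (mfderiv 𝓘(ℝ, E3) 𝓘(ℝ, E3) φ y v) = v := by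
  have h := mfderiv_comp y (hψ.mdifferentiableAt (by simp) (x := φ y)) (hφ.mdifferentiableAt (by simp))
  rw [hid, mfderiv_id] at h
  have h' := DFunLike.congr_fun h v
  exact h'.symm

/-- A smooth self-map of the slice with a smooth left inverse has injective differentials. [folklore] -/
theorem injective_mfderiv_of_comp_eq_id (hφ : ContMDiff 𝓘(ℝ, E3) 𝓘(ℝ, E3) ∞ φ) (hψ : ContMDiff 𝓘(ℝ, E3) 𝓘(ℝ, E3) ∞ ψ)
    (hid : ψ ∘ φ = id) (y : Kerr.slice 0 r₁) : Function.Injective (mfderiv 𝓘(ℝ, E3) 𝓘(ℝ, E3) φ y) :=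
  fun v w h ↦ by
    rw [← mfderiv_comp_apply_of_comp_eq_id hφ hψ hid y v, ← mfderiv_comp_apply_of_comp_eq_id hφ hψ hid y w]
    exact congrArg _ h

/-- **Below `4M` a re-scaling whose profile is the identity there is the identity near `x`** (as a self-map of
the slice). [folklore] -/
theorem eventuallyEq_id_of_radialScale {c : ℝ} (hfid : ∀ s, s ≤ c → f s = s)
    (hφ : ∀ y, (φ y : E3) = (f ‖(y : E3)‖ / ‖(y : E3)‖) • (y : E3)) {x : Kerr.slice 0 r₁} (hx : ‖(x : E3)‖ < c) :
    φ =ᶠ[𝓝 x] id := by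
  have hev := radialScale_eventuallyEq_id hfid (Kerr.ne_zero_of_mem_slice_zero x) hx
  have hev' : ∀ᶠ z : Kerr.slice 0 r₁ in 𝓝 x, (f ‖(z : E3)‖ / ‖(z : E3)‖) • (z : E3) = z :=
    continuous_subtype_val.continuousAt.eventually hev
  filter_upwards [hev'] with z hz
  exact Subtype.ext (by rw [hφ, hz, id])

/-- Hence it is the identity to first order at `x`: `φ x = x` and `dφ_x = id`. [folklore] -/
theorem mfderiv_eq_id_of_radialScale {c : ℝ} (hfid : ∀ s, s ≤ c → f s = s)
    (hφ : ∀ y, (φ y : E3) = (f ‖(y : E3)‖ / ‖(y : E3)‖) • (y : E3)) {x : Kerr.slice 0 r₁} (hx : ‖(x : E3)‖ < c) (v : E3) :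
    φ x = x ∧ mfderiv 𝓘(ℝ, E3) 𝓘(ℝ, E3) φ x v = v := by
  have hev := eventuallyEq_id_of_radialScale hfid hφ hx
  refine ⟨hev.eq_of_nhds, ?_⟩
  rw [hev.mfderiv_eq, mfderiv_id]
  rfl

end Maps

section Far

variable {M : ℝ} {Q : ℝ → ℝ}

/-- **The Boyer–Lindquist derivatives of the re-read leaf beyond `7M`.** Where `Q(ρ) = (2ρ + M)²/(4ρ)` (on
`ρ > 6M`) and `ρ > 7M`: `Q(ρ) > 8M`, `Q′ = (2ρ − M)(2ρ + M)/(4ρ²)`, and `(T ∘ Q)′ = T′(Q) Q′ = 2M(2ρ + M)/(ρ(2ρ − M))`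
with `T′ = 2M/(r − 2M)` the Boyer–Lindquist slope on `r ≥ 8M` (adapted from `Bridge.rim_inner_deriv`, the same
algebra on the other sheet). [cite: Wald1984, §6.4] -/
theorem far_deriv (hM : 0 < M) (hin : ∀ t ∈ Ioi (6 * M), Q t = (2 * t + M) ^ 2 / (4 * t)) {s : ℝ} (hs : 7 * M < s) :
    8 * M < Q s ∧ HasDerivAt Q ((2 * s - M) * (2 * s + M) / (4 * s ^ 2)) s ∧
      HasDerivAt (fun t ↦ Negative.bentHeight M 0 (Q t)) (2 * M * (2 * s + M) / (s * (2 * s - M))) s := by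
  -- adapted from `Bridge.rim_inner_deriv` (`…StubBridgeAnnulus`)
  have h0M : |(0 : ℝ)| < M := by rwa [abs_zero]
  have hs6 : s ∈ Ioi (6 * M) := by simp only [mem_Ioi]; linarith
  have hs0 : 0 < s := by linarith
  have hsM : 2 * s - M ≠ 0 := by intro h; linarith
  have hsM' : s * 2 - M ≠ 0 := by rwa [mul_comm] at hsM
  have hpM : 2 * s + M ≠ 0 := by intro h; linarith
  have hpM' : s * 2 + M ≠ 0 := by rwa [mul_comm] at hpM
  have hs' : s ≠ 0 := hs0.ne'
  set r := (2 * s + M) ^ 2 / (4 * s) with hr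
  have hr8 : 8 * M < r := by
    rw [hr, lt_div_iff₀ (by positivity)]; nlinarith
  have hr0 : 0 < r := lt_trans (by positivity) hr8
  have hr0' : r ≠ 0 := hr0.ne'
  have hr2 : r - 2 * M = (2 * s - M) ^ 2 / (4 * s) := by rw [hr]; field_simp; ring
  have hev : ∀ᶠ t in 𝓝 s, t ∈ Ioi (6 * M) := isOpen_Ioi.mem_nhds hs6
  have hϱ : HasDerivAt Q ((2 * s - M) * (2 * s + M) / (4 * s ^ 2)) s :=
    (Bridge.hasDerivAt_rhoIso hs').congr_of_eventuallyEq (hev.mono fun t ht ↦ hin t ht)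
  have hslope : Negative.bentSlope M 0 r = 2 * M * r / (r * (r - 2 * M)) := by
    rw [Negative.bentSlope_eq_of_ge hM hr8.le]; ring_nf
  have hτ : HasDerivAt (fun t ↦ Negative.bentHeight M 0 (Q t))
      (Negative.bentSlope M 0 r * ((2 * s - M) * (2 * s + M) / (4 * s ^ 2))) s := by
    have h := (Negative.hasDerivAt_bentHeight h0M r).comp s (Bridge.hasDerivAt_rhoIso (M := M) hs')
    refine h.congr_of_eventuallyEq (hev.mono fun t ht ↦ ?_)
    show Negative.bentHeight M 0 (Q t) = Negative.bentHeight M 0 ((2 * t + M) ^ 2 / (4 * t))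
    rw [hin t ht]
  have ht₁ : Negative.bentSlope M 0 r * ((2 * s - M) * (2 * s + M) / (4 * s ^ 2)) =
      2 * M * (2 * s + M) / (s * (2 * s - M)) := by
    rw [hslope, hr2]
    field_simp
  rw [ht₁] at hτ
  exact ⟨by rw [hin s hs6]; exact hr8, hϱ, hτ⟩

end Far

section LeafZone

variable {M r₁ : ℝ}

/-- Congruence of the sections of an initial data set in the point and the two vectors. [folklore] -/
theorem h_inner_congr {U : Opens E3} (D : InitialDataSet 𝓘(ℝ, E3) U) {x x' : U} (hx : x = x') {v v' w w' : E3}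
    (hv : v = v') (hw : w = w') : D.h.inner x v w = D.h.inner x' v' w' := by
  subst hx hv hw; rfl

/-- Congruence of the tensor `k` of an initial data set in the point and the two vectors. [folklore] -/
theorem k_congr {U : Opens E3} (D : InitialDataSet 𝓘(ℝ, E3) U) {x x' : U} (hx : x = x') {v v' w w' : E3}
    (hv : v = v') (hw : w = w') : D.k x v w = D.k x' v' w' := by
  subst hx hv hw; rfl

/-- The coordinate representative `z ↦ (T(r(0, z)), z)` of the pinned graph is `C^∞` (`M > 0`). [folklore] -/
theorem contDiff_graphRep (hM : 0 < M) :
    ContDiff ℝ ∞ (fun z : E3 ↦ E4.ofTimeSpace (Negative.bentHeight M 0 (Kerr.radius 0 (E4.ofTimeSpace 0 z))) z) := by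
  have h : (fun z : E3 ↦ E4.ofTimeSpace (Negative.bentHeight M 0 (Kerr.radius 0 (E4.ofTimeSpace 0 z))) z) =
      fun z ↦ Negative.bentHeight M 0 (Kerr.radius 0 (E4.ofTimeSpace 0 z)) • E4.basisVector 0 + E4.spaceEmbed z :=
    funext fun z ↦ E4.ofTimeSpace_eq_smul_add' _ _
  rw [h]
  exact ((contDiff_bentHeight_radius hM 0).smul contDiff_const).add E4.spaceEmbed.contDiff

variable [Kerr.Facts]

/-- **The leaf-zone datum.** Let `M > 0`, `0 < r₁ < 4M`, `(Q, S)` a radial profile as in `…AssemblyProfile`, and let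
the pinned graph `ψ_T = Negative.graph M 0 r₁` be a spacelike immersion with a future unit normal represented by
`N₀` (smooth on the slice); let `hInd` be the induced-vacuum-data packaging for the chart `(Kerr.region 0 r₁, g_{M,0})`.
Then on `Kerr.slice 0 r₁` there are the mutually inverse smooth re-scalings `φ = φ_S`, `ψ = ψ_Q` and the datum
`Dl = ψ_Q^*(ψ_T^* g, K_{N₀})`, which solves the vacuum constraints, equals `(hRep M, kRep M)` below `4M`, equals
`((1 + M/2|x|)⁴ δ, 0)` beyond `7M`, and satisfies `(φ^* Dl)_y = ((ψ_T^* g)_y, (K_{N₀})_y)`.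
[cite: BartnikIsenberg2004, §2] [cite: Wald1984, §6.4] -/
theorem exists_leafZoneData (hM : 0 ≤ M) (hM0 : 0 < M) (hr₁ : 0 < r₁) (hr₁4 : r₁ < 4 * M)
    (hInd : ∀ (U : Opens E3) (Φ N : E3 → E4) (f : U → Kerr.region 0 r₁) (ν : NormalField 𝓘(ℝ, E4) f),
      (∀ y : U, ((f y : Kerr.region 0 r₁) : E4) = Φ y) → (∀ y : U, ν y = N y) →
      ContDiffOn ℝ ∞ Φ (U : Set E3) → ContDiffOn ℝ ∞ N (U : Set E3) →
      (Kerr.smoothMetric M 0 r₁).IsSpacelikeImmersion 𝓘(ℝ, E3) f →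
      (Kerr.smoothMetric M 0 r₁).IsUnitNormal 𝓘(ℝ, E3) f ν (-1) →
      ∃ D : InitialDataSet 𝓘(ℝ, E3) U,
        (∀ y : U, D.h.inner y = (Kerr.smoothMetric M 0 r₁).inducedBilin 𝓘(ℝ, E3) f y) ∧
        (∀ [(Kerr.smoothMetric M 0 r₁).HasLeviCivita] (y : U),
          (D.k y).toLinearMap₁₂ = (Kerr.smoothMetric M 0 r₁).secondFundamentalForm 𝓘(ℝ, E3) f ν y) ∧
        (∀ [D.metric.HasLeviCivita], D.IsVacuumConstraintSolution))
    (hsp : (Kerr.smoothMetric M 0 r₁).IsSpacelikeImmersion 𝓘(ℝ, E3) (Negative.graph M 0 r₁))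
    {N₀ : E3 → E4} (hN₀ : ContDiffOn ℝ ∞ N₀ (Kerr.slice 0 r₁ : Set E3))
    (hν : (Kerr.smoothMetric M 0 r₁).IsFutureUnitNormal 𝓘(ℝ, E3) ((Kerr.timeOrientation M 0 r₁ hM).ofLE le_top)
      (Negative.graph M 0 r₁) (fun y ↦ N₀ y))
    {Q S : ℝ → ℝ} (hQs : ContDiff ℝ ∞ Q) (hSs : ContDiff ℝ ∞ S) (hQm : StrictMono Q) (hSm : StrictMono S)
    (hSQ : ∀ ρ, S (Q ρ) = ρ) (hQS : ∀ r, Q (S r) = r) (hQid : ∀ ρ, ρ ≤ 4 * M → Q ρ = ρ)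
    (hSid : ∀ r, r ≤ 4 * M → S r = r) (hQfar : ∀ ρ, 6 * M ≤ ρ → Q ρ = (2 * ρ + M) ^ 2 / (4 * ρ)) :
    ∃ (φ ψ : Kerr.slice 0 r₁ → Kerr.slice 0 r₁) (Dl : InitialDataSet 𝓘(ℝ, E3) (Kerr.slice 0 r₁)),
      (∀ y, (φ y : E3) = (S ‖(y : E3)‖ / ‖(y : E3)‖) • (y : E3)) ∧
      (∀ y, ψ (φ y) = y) ∧ (∀ x, φ (ψ x) = x) ∧
      ContMDiff 𝓘(ℝ, E3) 𝓘(ℝ, E3) ∞ φ ∧ ContMDiff 𝓘(ℝ, E3) 𝓘(ℝ, E3) ∞ ψ ∧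
      (∀ [Dl.metric.HasLeviCivita], Dl.IsVacuumConstraintSolution) ∧
      (∀ x : Kerr.slice 0 r₁, ‖(x : E3)‖ < 4 * M → ∀ v w : E3,
        Dl.h.inner x v w = Kerr.hRep M x v w ∧ Dl.k x v w = Kerr.kRep M x v w) ∧
      (∀ x : Kerr.slice 0 r₁, 7 * M < ‖(x : E3)‖ → ∀ v w : E3,
        Dl.h.inner x v w = Schwarzschild.conformalFactor M x ^ 4 * ⟪v, w⟫_ℝ ∧ Dl.k x v w = 0) ∧
      (∀ (y : Kerr.slice 0 r₁) (v w : E3),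
        Dl.h.inner (φ y) (mfderiv 𝓘(ℝ, E3) 𝓘(ℝ, E3) φ y v) (mfderiv 𝓘(ℝ, E3) 𝓘(ℝ, E3) φ y w) =
          (Kerr.smoothMetric M 0 r₁).inducedBilin 𝓘(ℝ, E3) (Negative.graph M 0 r₁) y v w) ∧
      (∀ [(Kerr.smoothMetric M 0 r₁).HasLeviCivita] (y : Kerr.slice 0 r₁) (v w : E3),
        Dl.k (φ y) (mfderiv 𝓘(ℝ, E3) 𝓘(ℝ, E3) φ y v) (mfderiv 𝓘(ℝ, E3) 𝓘(ℝ, E3) φ y w) =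
          (Kerr.smoothMetric M 0 r₁).secondFundamentalForm 𝓘(ℝ, E3) (Negative.graph M 0 r₁)
            (fun y ↦ N₀ y) y v w) := by
  have h0 : |(0 : ℝ)| < M := by rwa [abs_zero]
  have hSr : S r₁ = r₁ := hSid r₁ hr₁4.le
  have hQr : Q r₁ = r₁ := hQid r₁ hr₁4.le
  -- the two re-scalings
  set φ : Kerr.slice 0 r₁ → Kerr.slice 0 r₁ := fun y ↦
    ⟨(S ‖(y : E3)‖ / ‖(y : E3)‖) • (y : E3), radialScale_mem_slice hr₁ hSm hSr y.2⟩ with hφ_def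
  set ψ : Kerr.slice 0 r₁ → Kerr.slice 0 r₁ := fun y ↦
    ⟨(Q ‖(y : E3)‖ / ‖(y : E3)‖) • (y : E3), radialScale_mem_slice hr₁ hQm hQr y.2⟩ with hψ_def
  have hφ : ∀ y, (φ y : E3) = (S ‖(y : E3)‖ / ‖(y : E3)‖) • (y : E3) := fun _ ↦ rfl
  have hψ : ∀ y, (ψ y : E3) = (Q ‖(y : E3)‖ / ‖(y : E3)‖) • (y : E3) := fun _ ↦ rfl
  have hψφ : ψ ∘ φ = id := comp_eq_id_of_radialScale hr₁ hSm hSr hQS hφ hψ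
  have hφψ : φ ∘ ψ = id := comp_eq_id_of_radialScale hr₁ hQm hQr hSQ hψ hφ
  have hψφy : ∀ y, ψ (φ y) = y := fun y ↦ congrFun hψφ y
  have hφψx : ∀ x, φ (ψ x) = x := fun x ↦ congrFun hφψ x
  have hφs : ContMDiff 𝓘(ℝ, E3) 𝓘(ℝ, E3) ∞ φ := contMDiff_of_radialScale hSs hφ le_rfl
  have hψs : ContMDiff 𝓘(ℝ, E3) 𝓘(ℝ, E3) ∞ ψ := contMDiff_of_radialScale hQs hψ le_rfl
  have hψs' : ContMDiff 𝓘(ℝ, E3) 𝓘(ℝ, E3) (∞ + 1) ψ := hψs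
  have hψinj : ∀ x, Function.Injective (mfderiv 𝓘(ℝ, E3) 𝓘(ℝ, E3) ψ x) :=
    injective_mfderiv_of_comp_eq_id hψs hφs hφψ
  have hnψ : ∀ x : Kerr.slice 0 r₁, ‖(ψ x : E3)‖ = Q ‖(x : E3)‖ := norm_radialScale_slice hr₁ hQm hQr
  -- the datum induced on the leaf
  obtain ⟨Dleaf, hDh, hDk, hDvac⟩ := hInd (Kerr.slice 0 r₁)
    (fun z : E3 ↦ E4.ofTimeSpace (Negative.bentHeight M 0 (Kerr.radius 0 (E4.ofTimeSpace 0 z))) z) N₀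
    (Negative.graph M 0 r₁) (fun y ↦ N₀ y) (fun _ ↦ rfl) (fun _ ↦ rfl) (contDiff_graphRep hM0).contDiffOn hN₀ hsp hν.1
  haveI hLC : (Kerr.smoothMetric M 0 r₁).HasLeviCivita :=
    PseudoRiemannianMetric.hasLeviCivita (Kerr.smoothMetric M 0 r₁).toPseudoRiemannianMetric
  set Dl := Dleaf.comap ψ hψs' hψinj with hDl
  refine ⟨φ, ψ, Dl, hφ, hψφy, hφψx, hφs, hψs, ?_, ?_, ?_, ?_, ?_⟩
  · -- vacuum
    intro _
    haveI : Dleaf.metric.HasLeviCivita := PseudoRiemannianMetric.hasLeviCivita _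
    exact InitialDataSet.isVacuumConstraintSolution_comap' Dleaf hψs' hψinj hDvac
  · -- below `4M`: the Kerr–Schild slice data
    intro x hx v w
    have hψx : ψ x = x := (mfderiv_eq_id_of_radialScale hQid hψ hx v).1
    have hdv : mfderiv 𝓘(ℝ, E3) 𝓘(ℝ, E3) ψ x v = v := (mfderiv_eq_id_of_radialScale hQid hψ hx v).2
    have hdw : mfderiv 𝓘(ℝ, E3) 𝓘(ℝ, E3) ψ x w = w := (mfderiv_eq_id_of_radialScale hQid hψ hx w).2
    constructor
    · rw [hDl, InitialDataSet.comap_h_inner, h_inner_congr Dleaf hψx hdv hdw, hDh x]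
      exact inducedBilin_graph_of_lt hM0 hx v w
    · rw [hDl, InitialDataSet.comap_k, k_congr Dleaf hψx hdv hdw]
      have hk : Dleaf.k x v w = (Kerr.smoothMetric M 0 r₁).secondFundamentalForm 𝓘(ℝ, E3) (Negative.graph M 0 r₁)
          (fun y ↦ N₀ y) x v w := congrArg (fun B : LinearMap.BilinForm ℝ E3 ↦ B v w) (hDk x)
      rw [hk]
      exact secondFundamentalForm_graph_of_lt hM hM0 hν hN₀ hx v w
  · -- beyond `7M`: isotropic Schwarzschild, time-symmetric
    intro x hx7 v w
    have hx0 : (x : E3) ≠ 0 := Kerr.ne_zero_of_mem_slice_zero x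
    obtain ⟨h8, hdQ, hdTQ⟩ := far_deriv hM0 (fun t ht ↦ hQfar t (le_of_lt ht)) hx7
    have hQpos : 0 < Q ‖(x : E3)‖ := by linarith
    have hψx8 : 8 * M < ‖(ψ x : E3)‖ := by rw [hnψ]; exact h8
    have hgd : MDifferentiableAt 𝓘(ℝ, E3) 𝓘(ℝ, E4) (Negative.graph M 0 r₁) (ψ x) :=
      hsp.contMDiff.mdifferentiableAt (by simp)
    have hψd : MDifferentiableAt 𝓘(ℝ, E3) 𝓘(ℝ, E3) ψ x := hψs.mdifferentiableAt (by simp)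
    constructor
    · rw [hDl, InitialDataSet.comap_h_inner, hDh (ψ x), PseudoRiemannianMetric.inducedBilin_apply]
      have hchain : ∀ u : E3, mfderiv 𝓘(ℝ, E3) 𝓘(ℝ, E4) (Negative.graph M 0 r₁) (ψ x)
          (mfderiv 𝓘(ℝ, E3) 𝓘(ℝ, E3) ψ x u) = mfderiv 𝓘(ℝ, E3) 𝓘(ℝ, E4) (Negative.graph M 0 r₁ ∘ ψ) x u :=
        fun u ↦ by rw [mfderiv_comp x hgd hψd]; rfl
      rw [hchain v, hchain w]
      -- the re-read leaf `graph ∘ ψ` is the radial map with profile `(T ∘ Q, Q)`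
      set τF : ℝ → ℝ := fun t ↦ Negative.bentHeight M 0 (Q t) with hτF
      set τF' : ℝ → ℝ := fun t ↦ 2 * M * (2 * t + M) / (t * (2 * t - M)) with hτF'
      set ϱF' : ℝ → ℝ := fun t ↦ (2 * t - M) * (2 * t + M) / (4 * t ^ 2) with hϱF'
      set ΦF : E3 → E4 := fun z ↦ τF ‖z‖ • E4.basisVector 0 + (Q ‖z‖ / ‖z‖) • E4.spaceEmbed z with hΦF_def
      have hΦF : ∀ z, ΦF z = τF ‖z‖ • E4.basisVector 0 + (Q ‖z‖ / ‖z‖) • E4.spaceEmbed z := fun _ ↦ rfl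
      have hFF : ∀ y : Kerr.slice 0 r₁, (((Negative.graph M 0 r₁ ∘ ψ) y : Kerr.region 0 r₁) : E4) = ΦF y := by
        intro y
        have hQy : 0 < Q ‖(y : E3)‖ := by
          have := hnψ y; rw [← this]; exact Kerr.norm_pos_of_mem_slice_zero (ψ y)
        rw [Function.comp_apply, graph_repr (ψ y), hnψ y, hψ y, map_smul, hΦF, id, div_self hQy.ne', one_smul]
      rw [Bridge.mfderiv_of_radialMap_apply (τ := τF) (ϱ := Q) (τ' := τF') (ϱ' := ϱF') hΦF hFF x hx0 hdTQ hdQ v,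
        Bridge.mfderiv_of_radialMap_apply (τ := τF) (ϱ := Q) (τ' := τF') (ϱ' := ϱF') hΦF hFF x hx0 hdTQ hdQ w]
      have hxsp : E4.spatial (((Negative.graph M 0 r₁ ∘ ψ) x : Kerr.region 0 r₁) : E4) =
          (Q ‖(x : E3)‖ / ‖(x : E3)‖) • (x : E3) := by rw [hFF x]; exact Bridge.spatial_radialMap hΦF x
      have hsM : 2 * ‖(x : E3)‖ - M ≠ 0 := by intro h; linarith
      have hgoal := Bridge.bilin_tangent_tangent_eq_iso M hx0 hsM hQpos hxsp (hQfar _ (by linarith))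
        (rfl : ϱF' ‖(x : E3)‖ = _) (rfl : τF' ‖(x : E3)‖ = _) v w
      rw [Schwarzschild.conformalFactor_apply]
      exact hgoal
    · rw [hDl, InitialDataSet.comap_k]
      have hk : Dleaf.k (ψ x) (mfderiv 𝓘(ℝ, E3) 𝓘(ℝ, E3) ψ x v) (mfderiv 𝓘(ℝ, E3) 𝓘(ℝ, E3) ψ x w) =
          (Kerr.smoothMetric M 0 r₁).secondFundamentalForm 𝓘(ℝ, E3) (Negative.graph M 0 r₁) (fun y ↦ N₀ y) (ψ x)
            (mfderiv 𝓘(ℝ, E3) 𝓘(ℝ, E3) ψ x v) (mfderiv 𝓘(ℝ, E3) 𝓘(ℝ, E3) ψ x w) :=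
        congrArg (fun B : LinearMap.BilinForm ℝ E3 ↦ B (mfderiv 𝓘(ℝ, E3) 𝓘(ℝ, E3) ψ x v)
          (mfderiv 𝓘(ℝ, E3) 𝓘(ℝ, E3) ψ x w)) (hDk (ψ x))
      rw [hk]
      exact secondFundamentalForm_graph_eq_zero_of_lt h0 hsp hν.1 hN₀ hψx8 _ _
  · -- the pull-back identity for `h`
    intro y v w
    rw [hDl, InitialDataSet.comap_h_inner, h_inner_congr Dleaf (hψφy y)
      (mfderiv_comp_apply_of_comp_eq_id hφs hψs hψφ y v) (mfderiv_comp_apply_of_comp_eq_id hφs hψs hψφ y w), hDh y]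
  · -- the pull-back identity for `k`
    intro _ y v w
    rw [hDl, InitialDataSet.comap_k, k_congr Dleaf (hψφy y)
      (mfderiv_comp_apply_of_comp_eq_id hφs hψs hψφ y v) (mfderiv_comp_apply_of_comp_eq_id hφs hψs hψφ y w)]
    exact congrArg (fun B : LinearMap.BilinForm ℝ E3 ↦ B v w) (hDk y)

end LeafZone

end Assembly

/-- **Registered export of this file** (sub-goal `assembly_leafMaps` of stub `stub_assembly`): the Boyer–Lindquist derivatives of the re-read leaf beyond `7M`, `Assembly.far_deriv`. [cite: Wald1984, §6.4] -/
theorem assembly_leafMaps :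
    ∀ (M : ℝ) (Q : ℝ → ℝ), 0 < M → (∀ t ∈ Set.Ioi (6 * M), Q t = (2 * t + M) ^ 2 / (4 * t)) → ∀ (s : ℝ), 7 * M < s → 8 * M < Q s ∧ HasDerivAt Q ((2 * s - M) * (2 * s + M) / (4 * s ^ 2)) s ∧ HasDerivAt (fun t ↦ Negative.bentHeight M 0 (Q t)) (2 * M * (2 * s + M) / (s * (2 * s - M))) s :=
  fun _ _ hM hin _ hs ↦ Assembly.far_deriv hM hin hs

/-- **Registered export of this file** (sub-goal `assembly_leafZone` of stub `stub_assembly`): the leaf-zone datum and its properties, `Assembly.exists_leafZoneData`. [cite: BartnikIsenberg2004, §2] -/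
theorem assembly_leafZone :
    ∀ [Kerr.Facts] (M r₁ : ℝ) (hM : 0 ≤ M), 0 < M → 0 < r₁ → r₁ < 4 * M → (∀ (U : TopologicalSpace.Opens E3) (Φ N : E3 → E4) (f : U → Kerr.region 0 r₁) (ν : NormalField 𝓘(ℝ, E4) f), (∀ y : U, ((f y : Kerr.region 0 r₁) : E4) = Φ y) → (∀ y : U, ν y = N y) → ContDiffOn ℝ ∞ Φ (U : Set E3) → ContDiffOn ℝ ∞ N (U : Set E3) → (Kerr.smoothMetric M 0 r₁).IsSpacelikeImmersion 𝓘(ℝ, E3) f → (Kerr.smoothMetric M 0 r₁).IsUnitNormal 𝓘(ℝ, E3) f ν (-1) → ∃ D : InitialDataSet 𝓘(ℝ, E3) U, (∀ y : U, D.h.inner y = (Kerr.smoothMetric M 0 r₁).inducedBilin 𝓘(ℝ, E3) f y) ∧ (∀ [(Kerr.smoothMetric M 0 r₁).HasLeviCivita] (y : U), (D.k y).toLinearMap₁₂ = (Kerr.smoothMetric M 0 r₁).secondFundamentalForm 𝓘(ℝ, E3) f ν y) ∧ (∀ [D.metric.HasLeviCivita], D.IsVacuumConstraintSolution)) → (Kerr.smoothMetric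 M 0 r₁).IsSpacelikeImmersion 𝓘(ℝ, E3) (Negative.graph M 0 r₁) → ∀ (N₀ : E3 → E4), ContDiffOn ℝ ∞ N₀ (Kerr.slice 0 r₁ : Set E3) → (Kerr.smoothMetric M 0 r₁).IsFutureUnitNormal 𝓘(ℝ, E3) ((Kerr.timeOrientation M 0 r₁ hM).ofLE le_top) (Negative.graph M 0 r₁) (fun y ↦ N₀ y) → ∀ (Q S : ℝ → ℝ), ContDiff ℝ ∞ Q → ContDiff ℝ ∞ S → StrictMono Q → StrictMono S → (∀ ρ, S (Q ρ) = ρ) → (∀ r, Q (S r) = r) → (∀ ρ, ρ ≤ 4 * M → Q ρ = ρ) → (∀ r, r ≤ 4 * M → S r = r) → (∀ ρ, 6 * M ≤ ρ → Q ρ = (2 * ρ + M) ^ 2 / (4 * ρ)) → ∃ (φ ψ : Kerr.slice 0 r₁ → Kerr.slice 0 r₁) (Dl : InitialDataSet 𝓘(ℝ, E3) (Kerr.slice 0 r₁)), (∀ y, (φ y : E3) = (S ‖(y : E3)‖ / ‖(y : E3)‖) • (y : E3)) ∧ (∀ y, ψ (φ y) = y) ∧ (∀ x, φ (ψ x) =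 x) ∧ ContMDiff 𝓘(ℝ, E3) 𝓘(ℝ, E3) ∞ φ ∧ ContMDiff 𝓘(ℝ, E3) 𝓘(ℝ, E3) ∞ ψ ∧ (∀ [Dl.metric.HasLeviCivita], Dl.IsVacuumConstraintSolution) ∧ (∀ x : Kerr.slice 0 r₁, ‖(x : E3)‖ < 4 * M → ∀ v w : E3, Dl.h.inner x v w = Kerr.hRep M x v w ∧ Dl.k x v w = Kerr.kRep M x v w) ∧ (∀ x : Kerr.slice 0 r₁, 7 * M < ‖(x : E3)‖ → ∀ v w : E3, Dl.h.inner x v w = Schwarzschild.conformalFactor M x ^ 4 * ⟪v, w⟫_ℝ ∧ Dl.k x v w = 0) ∧ (∀ (y : Kerr.slice 0 r₁) (v w : E3), Dl.h.inner (φ y) (mfderiv 𝓘(ℝ, E3) 𝓘(ℝ, E3) φ y v) (mfderiv 𝓘(ℝ, E3) 𝓘(ℝ, E3) φ y w) = (Kerr.smoothMetric M 0 r₁).inducedBilin 𝓘(ℝ, E3) (Negative.graph M 0 r₁) y v w) ∧ (∀ [(Kerr.smoothMetric M 0 r₁).HasLeviCivita] (y : Kerr.slice 0 r₁) (v w : E3),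 Dl.k (φ y) (mfderiv 𝓘(ℝ, E3) 𝓘(ℝ, E3) φ y v) (mfderiv 𝓘(ℝ, E3) 𝓘(ℝ, E3) φ y w) = (Kerr.smoothMetric M 0 r₁).secondFundamentalForm 𝓘(ℝ, E3) (Negative.graph M 0 r₁) (fun y ↦ N₀ y) y v w) :=
  fun _ _ hM hM0 hr₁ hr₁4 hInd hsp _ hN₀ hν _ _ hQs hSs hQm hSm hSQ hQS hQid hSid hQfar ↦
    Assembly.exists_leafZoneData hM hM0 hr₁ hr₁4 hInd hsp hN₀ hν hQs hSs hQm hSm hSQ hQS hQid hSid hQfar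

end Summit.FinalStateConjecture.FinalStateConjecture.Theorems.SwallowTheDatum

end
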